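import Literature.Analysis.Fourier.PhaseSymbolRescaling
import HarnessLib

/-!
# The rescaling argument of Brenner–Thomée–Wahlbin's Lemma 1.1, localized and with an
approximate phase relation

`PhaseSymbolRescaling.lean` proves the analytic heart of [BrennerThomeeWahlbin1975, Ch. 5 §1,
proof of Lemma 1.1] (`hessian_eq_zero_of_uniformPhaseBound`): if matrix symbols `N₀, N₁, …` lie
in `M_p` with ONE constant, `1 ≤ p ≤ ∞`, `p ≠ 2`, and on a ball `B` around `ξ⁰` one has the EXACT
phase relation `Nₙ(ξ)Π(ξ) = e^{i(n+1)λ(ξ)}Π(ξ)` with `Π` smooth, `Π(ξ⁰) ≠ 0`, then `λ''(ξ⁰) = 0`.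
This file proves the same conclusion under two weakenings of the hypotheses, both of which the
printed proof tolerates verbatim (`hessian_eq_zero_of_localizedApproxPhaseBound`):

1. **Localization.** Only the LOCALIZED symbols `θ(ξ)Nₙ(ξ)` are required to lie in `M_p` with one
   constant, for some real cut-off `θ` with `θ = 1` on `B`: the printed proof uses the hypothesis
   `exp(P̂) ∈ M_p` only through (1.5), `M_p(χ e^{inλ}) ≤ M_p(exp(nP̂)) M_p(χv) M_p(w*)`, i.e. through
   the products `exp(nP̂) · χv` with `χ ∈ C₀^∞(B)`, and `exp(nP̂) χv = (θ exp(nP̂)) χv`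
   [BrennerThomeeWahlbin1975, Ch. 5 §1, proof of Lemma 1.1, (1.5)]. This is the form in which the
   hypothesis arises from Rauch's estimate (5) at `p = 1` [Rauch1986, Proof of Theorem p. 483]
   without interpolation (Young's inequality only gives `χ(·/n)M_T ∈ M_1`, not `M_T ∈ M_1`).
2. **Approximate phase relation.** Instead of `NₙΠ = e^{i(n+1)λ}Π` it suffices that
   `Nₙ(ξ)Π(ξ) - e^{i(n+1)λ(ξ)}A(ξ) → 0` UNIFORMLY on `B`, entrywise, for some matrix function `A`
   continuous at `ξ⁰` with `A(ξ⁰) ≠ 0`, together with a uniform entrywise bound on `NₙΠ` on `B`: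
   the rescaled symbols `hₙ` of the printed proof then still converge pointwise and boundedly
   (the error is evaluated at the points `ξ⁰ + (n+1)^{-1/2}ξ ∈ B` and is multiplied by factors of
   modulus `≤ 1`), now to `e^{½iλ''(ξ,ξ)}A(ξ⁰)`, and [BrennerThomeeWahlbin1975, Ch. 1 Thm 2.6,
   Cor 5.3] apply as printed. This is the form produced by a zeroth-order term: for Rauch's
   multiplier `M(ξ) = exp(t̄A₀⁻¹(-Σ A_l iξ_l - B′(ū)))` [Rauch1986, Proof of Theorem p. 483] the
   dilates are `exp(-i(n+1)K(ξ) - E)` and first-order averaging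
   (`Literature.Analysis.ODE.norm_exp_phase_add_mul_idem_sub_le`) gives
   `exp(-i(n+1)K - E)Πₐ = e^{-i(n+1)μₐ}(exp(-E_d)Πₐ + O(1/n))`, an approximate phase relation with
   `A = exp(-E_d)Πₐ`.

The proof is that of `hessian_eq_zero_of_uniformPhaseBound`, with the two modifications just
described; the tools are the in-tree ones (`cutoffMatrix`, `tendsto_rescaled_taylor`, products,
translations, dilations, limits of multipliers, `e^{iQ} ∉ M_p`).

## Contents

* `hessian_eq_zero_of_localizedApproxPhaseBound` — the theorem;
* `fderiv_fderiv_apply_eq_zero_of_localizedApproxPhaseBound` — its `C^∞`-on-a-ball corollary;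
* `hessian_eq_zero_of_uniformPhaseBound'` — sanity check: the exact, global statement of
  `PhaseSymbolRescaling.lean` is the special case `θ = 1`, `A = Π`.

## References

* [BrennerThomeeWahlbin1975] P. Brenner, V. Thomée, L. B. Wahlbin, LNM 434 (1975), Ch. 5 §1,
  proof of Lemma 1.1, (1.4)–(1.5), pp. 92–93; Ch. 1 Thms 2.6–2.8, Cor 5.3.
* [Rauch1986] J. Rauch, Comm. Math. Phys. 106 (1986) 481–484, Proof of Theorem p. 483.
* [Brenner1973] P. Brenner, Ark. Mat. 11 (1973) 75–101, Thm 3.1 and Cor 3.1 p. 84; Lemma 5.2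
  p. 97 (Brenner's own removal of lower-order terms, by `t → 0`).
-/

noncomputable section

open MeasureTheory FourierTransform Complex Real Filter Topology Set Metric
open scoped ENNReal NNReal SchwartzMap ContDiff

namespace Literature.Analysis.Fourier

variable {V : Type*} [NormedAddCommGroup V] [InnerProductSpace ℝ V] [FiniteDimensional ℝ V]
  [MeasurableSpace V] [BorelSpace V] {ι κ : Type*} [Fintype ι] [Fintype κ]

/-! ### The theorem -/

/-- **The rescaling argument, localized and with an approximate phase relation.** Let
`N₀, N₁, …` be matrix symbols and `θ` a real function with `θ = 1` on `B = ball ξ₀ ρ` such that the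
localized symbols `θNₙ` lie in `M_p` with one constant `C`, `1 ≤ p ≤ ∞`, `p ≠ 2`. Let `λ` be real,
differentiable on `B` with derivative `λ'` differentiable at `ξ₀` (second derivative `λ''`), `Π`
a matrix function with entries smooth on `B`, `A` a matrix function continuous at `ξ₀` with
`A(ξ₀) ≠ 0`, such that the entries of `NₙΠ` are bounded on `B` uniformly in `n` and
`Nₙ(ξ)Π(ξ) - e^{i(n+1)λ(ξ)}A(ξ) → 0` uniformly on `B`, entrywise. Then `λ''(v, v) = 0` for every
`v`. Proof as printed for [BrennerThomeeWahlbin1975, Ch. 5 Lemma 1.1]: with a cut-off `χ`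
supported in `B`, `Sₙ = Nₙ · χΠ = (θNₙ) · χΠ ∈ M_p` uniformly; the rescaled symbols
`hₙ(ξ) = e^{-i((n+1)λ(ξ₀) + √(n+1)λ'(ξ₀)ξ)} Sₙ(ξ₀ + (n+1)^{-1/2}ξ)` are in `M_p` with the same
constant (translation, dilation, linear phase) and converge pointwise, boundedly, to
`e^{½iλ''(ξ,ξ)} A(ξ₀)` (the error term tends to `0` uniformly on `B` and carries a factor of
modulus `≤ 1`); hence the limit is in `M_p`, so is the scalar `e^{½iλ''(ξ,ξ)}` (a non-zero entry
of `A(ξ₀)`), and `e^{iQ} ∉ M_p` for `Q ≠ 0`, `p ≠ 2` forces `λ'' = 0`.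
[cite: BrennerThomeeWahlbin1975, Ch. 5 §1, proof of Lemma 1.1, (1.4)–(1.5)] -/
theorem hessian_eq_zero_of_localizedApproxPhaseBound [DecidableEq ι] [DecidableEq κ] {p : ℝ≥0∞}
    (hp1 : 1 ≤ p) (hp2 : p ≠ 2) {C : ℝ≥0} {N : ℕ → V → Matrix κ κ ℂ} {ξ₀ : V} {ρ : ℝ}
    (hρ : 0 < ρ) {θ : V → ℝ} (hθ : ∀ ξ ∈ ball ξ₀ ρ, θ ξ = 1)
    (hN : ∀ n, IsLpMultiplierWith p C (fun ξ => ((θ ξ : ℝ) : ℂ) • N n ξ))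
    {lam : V → ℝ} {lam' : V → V →L[ℝ] ℝ} {lam'' : V →L[ℝ] V →L[ℝ] ℝ}
    (hlam : ∀ ξ ∈ ball ξ₀ ρ, HasFDerivAt lam (lam' ξ) ξ) (hlam' : HasFDerivAt lam' lam'' ξ₀)
    {P : V → Matrix κ ι ℂ} (hP : ∀ a b, ContDiffOn ℝ ∞ (fun ξ => P ξ a b) (ball ξ₀ ρ))
    {A : V → Matrix κ ι ℂ} (hA : ∀ a b, ContinuousAt (fun ξ => A ξ a b) ξ₀) (hA0 : A ξ₀ ≠ 0)
    {B : ℝ} (hB : ∀ n, ∀ ξ ∈ ball ξ₀ ρ, ∀ a b, ‖(N n ξ * P ξ) a b‖ ≤ B)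
    (hNP : ∀ e : ℝ, 0 < e → ∀ᶠ n : ℕ in atTop, ∀ ξ ∈ ball ξ₀ ρ, ∀ a b,
      ‖(N n ξ * P ξ - cexp (I * ((((n : ℝ) + 1) * lam ξ : ℝ) : ℂ)) • A ξ) a b‖ ≤ e)
    (v : V) : lam'' v v = 0 := by
  -- the cut-off `χ` and the cut-off projection `Pχ = χΠ`: Schwartz entries, in `M_p`, temperate
  set χ : ContDiffBump ξ₀ := bump ξ₀ ρ hρ with hχdef
  set Pχ : V → Matrix κ ι ℂ := cutoffMatrix P ξ₀ ρ hρ with hPχ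
  have hχP : ∀ ξ, Pχ ξ = ((χ ξ : ℝ) : ℂ) • P ξ := fun ξ => rfl
  have hsch := exists_schwartz_cutoffMatrix hρ hP
  obtain ⟨CP, hCP⟩ := isLpMultiplier_of_schwartz_entries hp1 hsch
  have htemp := hasTemperateGrowth_of_schwartz_entries hsch
  -- facts about `χ`
  have hχ_le : ∀ ξ, ‖((χ ξ : ℝ) : ℂ)‖ ≤ 1 := fun ξ => by
    rw [Complex.norm_real, Real.norm_eq_abs, abs_of_nonneg χ.nonneg]
    exact χ.le_one
  have hχ_ball : ∀ ξ, χ ξ ≠ 0 → ξ ∈ ball ξ₀ ρ := by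
    intro ξ hξ
    have hs : ξ ∈ Function.support (χ : V → ℝ) := hξ
    rw [χ.support_eq] at hs
    exact ball_subset_ball (by change ρ / 2 ≤ ρ; linarith) hs
  have hχ0 : χ ξ₀ = 1 := χ.one_of_mem_closedBall (mem_closedBall_self χ.rIn_pos.le)
  -- `0 ≤ B`
  have hB0 : 0 ≤ B := by
    rcases isEmpty_or_nonempty κ with hκ | ⟨⟨a⟩⟩
    · exact absurd (Matrix.ext fun a _ => (IsEmpty.false a).elim) hA0
    rcases isEmpty_or_nonempty ι with hι | ⟨⟨b⟩⟩
    · exact absurd (Matrix.ext fun _ b => (IsEmpty.false b).elim) hA0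
    exact (norm_nonneg _).trans (hB 0 ξ₀ (mem_ball_self hρ) a b)
  -- `Sₙ = Nₙ Pχ = (θNₙ) Pχ ∈ M_p` with one constant
  have hS : ∀ n, IsLpMultiplierWith p (C * CP) (fun ξ => N n ξ * Pχ ξ) := by
    intro n
    have h1 := (hN n).mul_of_hasTemperateGrowth htemp hCP
    have heq : (fun ξ => ((θ ξ : ℝ) : ℂ) • N n ξ * Pχ ξ) = fun ξ => N n ξ * Pχ ξ := by
      funext ξ
      by_cases hξ : χ ξ = 0
      · rw [hχP ξ, hξ]
        simp
      · rw [hθ ξ (hχ_ball ξ hξ)]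
        simp
    rwa [heq] at h1
  -- the phase factors and the error term
  set Φ : ℕ → V → ℂ := fun n ξ => cexp (I * ((((n : ℝ) + 1) * lam ξ : ℝ) : ℂ)) with hΦ
  set R : ℕ → V → Matrix κ ι ℂ := fun n ξ => N n ξ * P ξ - Φ n ξ • A ξ with hR
  have hΦ1 : ∀ n ξ, ‖Φ n ξ‖ = 1 := fun n ξ => by
    rw [hΦ]
    dsimp only
    rw [mul_comm I, Complex.norm_exp_ofReal_mul_I]
  have hdec : ∀ n ξ, N n ξ * Pχ ξ = ((χ ξ : ℝ) : ℂ) • (Φ n ξ • A ξ + R n ξ) := by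
    intro n ξ
    rw [hχP, Matrix.mul_smul, hR]
    simp only [add_sub_cancel]
  -- the rescaling data
  set ε : ℕ → ℝ := fun n => 1 / Real.sqrt ((n : ℝ) + 1) with hε
  have hε0 : ∀ n, ε n ≠ 0 := fun n => by rw [hε]; positivity
  set a : ℕ → V := fun n => (-(Real.sqrt ((n : ℝ) + 1)) / (2 * π)) • dualVec (lam' ξ₀) with ha
  set u : ℕ → ℂ := fun n => cexp (-(I * ((((n : ℝ) + 1) * lam ξ₀ : ℝ) : ℂ))) with hu
  have hu1 : ∀ n, ‖u n‖ ≤ 1 := fun n => by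
    rw [hu]
    dsimp only
    rw [show -(I * ((((n : ℝ) + 1) * lam ξ₀ : ℝ) : ℂ)) = ((-(((n : ℝ) + 1) * lam ξ₀) : ℝ) : ℂ) * I by
      push_cast; ring, Complex.norm_exp_ofReal_mul_I]
  -- the rescaled symbols `hₙ`
  set h : ℕ → V → Matrix κ ι ℂ := fun n ξ =>
    u n • ((((𝐞 (inner ℝ (a n) ξ) : Circle) : ℂ)) • (N n (ε n • ξ + ξ₀) * Pχ (ε n • ξ + ξ₀)))
    with hh
  have hhM : ∀ n, IsLpMultiplierWith p (C * CP) (h n) := fun n =>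
    ((((hS n).comp_add ξ₀).comp_smul (hε0 n)).fourierChar_smul (a n)).unit_smul (hu1 n)
  -- the linear phase
  have hphase : ∀ n ξ, (((𝐞 (inner ℝ (a n) ξ) : Circle) : ℂ)) =
      cexp (-(I * ((Real.sqrt ((n : ℝ) + 1) * lam' ξ₀ ξ : ℝ) : ℂ))) := by
    intro n ξ
    rw [Real.fourierChar_apply, ha]
    dsimp only
    rw [real_inner_smul_left, inner_dualVec]
    congr 1
    have hπ : (π : ℂ) ≠ 0 := by exact_mod_cast Real.pi_ne_zero
    push_cast
    field_simp
  have he1 : ∀ n ξ, ‖(((𝐞 (inner ℝ (a n) ξ) : Circle) : ℂ))‖ = 1 := fun n ξ => Circle.norm_coe _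
  -- the combined phase `uₙ · 𝐞 · Φₙ` is the rescaled Taylor phase
  have hmain : ∀ n ξ, u n * (((𝐞 (inner ℝ (a n) ξ) : Circle) : ℂ)) * Φ n (ξ₀ + ε n • ξ) =
      cexp (I * ((((n : ℝ) + 1) * (lam (ξ₀ + ε n • ξ) - lam ξ₀ - ε n * lam' ξ₀ ξ) : ℝ) : ℂ)) := by
    intro n ξ
    rw [hu, hΦ, hphase]
    dsimp only
    rw [← Complex.exp_add, ← Complex.exp_add]
    congr 1
    have hsq : ((n : ℝ) + 1) * ε n = Real.sqrt ((n : ℝ) + 1) := by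
      rw [hε]; dsimp only
      rw [mul_one_div, div_eq_iff (Real.sqrt_pos.2 (by positivity)).ne', ← sq, sq_sqrt_nat_succ]
    have hre : ((n : ℝ) + 1) * (lam (ξ₀ + ε n • ξ) - lam ξ₀ - ε n * lam' ξ₀ ξ) =
        ((n : ℝ) + 1) * lam (ξ₀ + ε n • ξ) - ((n : ℝ) + 1) * lam ξ₀ -
          Real.sqrt ((n : ℝ) + 1) * lam' ξ₀ ξ := by
      rw [← hsq]; ring
    rw [hre]
    push_cast
    ring
  -- pointwise formulae for `hₙ`
  have hhf' : ∀ n ξ, h n ξ = (u n * (((𝐞 (inner ℝ (a n) ξ) : Circle) : ℂ)) *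
      ((χ (ξ₀ + ε n • ξ) : ℝ) : ℂ)) • (N n (ξ₀ + ε n • ξ) * P (ξ₀ + ε n • ξ)) := by
    intro n ξ
    rw [hh]
    dsimp only
    rw [add_comm (ε n • ξ) ξ₀, hχP, Matrix.mul_smul, smul_smul, smul_smul]
  have hhf : ∀ n ξ, h n ξ =
      (cexp (I * ((((n : ℝ) + 1) * (lam (ξ₀ + ε n • ξ) - lam ξ₀ - ε n * lam' ξ₀ ξ) : ℝ) : ℂ)) *
          ((χ (ξ₀ + ε n • ξ) : ℝ) : ℂ)) • A (ξ₀ + ε n • ξ) +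
        (u n * (((𝐞 (inner ℝ (a n) ξ) : Circle) : ℂ)) * ((χ (ξ₀ + ε n • ξ) : ℝ) : ℂ)) •
          R n (ξ₀ + ε n • ξ) := by
    intro n ξ
    rw [hh]
    dsimp only
    rw [add_comm (ε n • ξ) ξ₀, hdec, smul_add, smul_add, smul_add, ← hmain n ξ]
    simp only [smul_smul]
    congr 2 <;> ring
  -- pointwise limit
  have hεt : Tendsto ε atTop (𝓝 0) := by
    have h1 : Tendsto (fun n : ℕ => Real.sqrt ((n : ℝ) + 1)) atTop atTop :=
      Real.tendsto_sqrt_atTop.comp (tendsto_natCast_atTop_atTop.atTop_add tendsto_const_nhds)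
    have := h1.inv_tendsto_atTop
    refine this.congr fun n => ?_
    rw [hε]; simp
  have hlim : ∀ ξ, Tendsto (fun n => h n ξ) atTop
      (𝓝 (cexp (I * ((lam'' ξ ξ / 2 : ℝ) : ℂ)) • A ξ₀)) := by
    intro ξ
    have h2ξ : Tendsto (fun n => ξ₀ + ε n • ξ) atTop (𝓝 ξ₀) := by
      have := (hεt.smul_const ξ).const_add ξ₀
      rwa [zero_smul, add_zero] at this
    -- main term
    have hT1 : Tendsto (fun n : ℕ => (cexp (I * ((((n : ℝ) + 1) * (lam (ξ₀ + ε n • ξ) - lam ξ₀ -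
        ε n * lam' ξ₀ ξ) : ℝ) : ℂ)) * ((χ (ξ₀ + ε n • ξ) : ℝ) : ℂ)) • A (ξ₀ + ε n • ξ)) atTop
        (𝓝 ((cexp (I * ((lam'' ξ ξ / 2 : ℝ) : ℂ)) * 1) • A ξ₀)) := by
      refine Tendsto.smul (Tendsto.mul ?_ ?_) ?_
      · have h1 := tendsto_rescaled_taylor hρ hlam hlam' ξ
        exact (Complex.continuous_exp.tendsto _).comp
          ((Complex.continuous_ofReal.tendsto _).comp h1 |>.const_mul I)
      · have h3 := ((Complex.continuous_ofReal.comp χ.continuous).tendsto ξ₀).comp h2ξ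
        simpa [Function.comp_def, hχ0] using h3
      · refine tendsto_pi_nhds.2 fun a' => tendsto_pi_nhds.2 fun b' => ?_
        exact (hA a' b').tendsto.comp h2ξ
    -- error term
    have hT2 : Tendsto (fun n : ℕ => (u n * (((𝐞 (inner ℝ (a n) ξ) : Circle) : ℂ)) *
        ((χ (ξ₀ + ε n • ξ) : ℝ) : ℂ)) • R n (ξ₀ + ε n • ξ)) atTop (𝓝 0) := by
      refine tendsto_pi_nhds.2 fun a' => tendsto_pi_nhds.2 fun b' => ?_
      simp only [Matrix.zero_apply]
      rw [NormedAddGroup.tendsto_nhds_zero]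
      intro e he
      filter_upwards [hNP (e / 2) (by positivity)] with n hn
      simp only [Matrix.smul_apply, smul_eq_mul, norm_mul]
      by_cases hχη : χ (ξ₀ + ε n • ξ) = 0
      · rw [hχη]
        simp only [Complex.ofReal_zero, norm_zero, mul_zero, zero_mul]
        exact he
      · have hmem := hχ_ball _ hχη
        have hRle : ‖R n (ξ₀ + ε n • ξ) a' b'‖ ≤ e / 2 := hn _ hmem a' b'
        calc ‖u n‖ * ‖(((𝐞 (inner ℝ (a n) ξ) : Circle) : ℂ))‖ * ‖((χ (ξ₀ + ε n • ξ) : ℝ) : ℂ)‖ *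
              ‖R n (ξ₀ + ε n • ξ) a' b'‖ ≤ 1 * 1 * 1 * (e / 2) := by
                gcongr
                · exact hu1 n
                · exact (he1 n ξ).le
                · exact hχ_le _
          _ < e := by linarith
    have hsum := hT1.add hT2
    rw [mul_one, add_zero] at hsum
    exact hsum.congr fun n => (hhf n ξ).symm
  -- uniform entrywise bound
  have hbound : ∀ n ξ i j, ‖h n ξ i j‖ ≤ B := by
    intro n ξ i j
    rw [hhf' n ξ, Matrix.smul_apply, smul_eq_mul, norm_mul]
    by_cases hχη : χ (ξ₀ + ε n • ξ) = 0
    · rw [hχη]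
      simp only [Complex.ofReal_zero, mul_zero, norm_zero, zero_mul]
      exact hB0
    · have hmem := hχ_ball _ hχη
      calc ‖u n * (((𝐞 (inner ℝ (a n) ξ) : Circle) : ℂ)) * ((χ (ξ₀ + ε n • ξ) : ℝ) : ℂ)‖ *
            ‖(N n (ξ₀ + ε n • ξ) * P (ξ₀ + ε n • ξ)) i j‖ ≤ 1 * B := by
              gcongr
              · rw [norm_mul, norm_mul]
                calc ‖u n‖ * ‖(((𝐞 (inner ℝ (a n) ξ) : Circle) : ℂ))‖ * ‖((χ (ξ₀ + ε n • ξ) : ℝ) : ℂ)‖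
                    ≤ 1 * 1 * 1 := by
                      gcongr
                      · exact hu1 n
                      · exact (he1 n ξ).le
                      · exact hχ_le _
                  _ = 1 := by ring
              · exact hB n _ hmem i j
        _ = B := one_mul B
  -- the limit is a multiplier
  have hL : IsLpMultiplierWith p (C * CP) (fun ξ => cexp (I * ((lam'' ξ ξ / 2 : ℝ) : ℂ)) • A ξ₀) :=
    IsLpMultiplierWith.of_tendsto hhM hlim hB0 hbound
  -- extract a non-zero entry
  obtain ⟨a₀, b₀, hab⟩ := exists_apply_ne_zero_of_ne_zero hA0
  have hscal := isLpMultiplier_entry hL.isLpMultiplier hab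
  -- the symmetric operator of `½λ''`
  have hsymm : ∀ v w, lam'' v w = lam'' w v := fun v w =>
    second_derivative_symmetric_of_eventually (f := lam) (f' := lam')
      (by filter_upwards [isOpen_ball.mem_nhds (mem_ball_self hρ)] with y hy using hlam y hy) hlam' v w
  set S : V →ₗ[ℝ] V := bilinOp ((1 / 2 : ℝ) • lam'') with hSdef
  have hSs : S.IsSymmetric := isSymmetric_bilinOp fun v w => by
    simp only [smul_apply, smul_eq_mul, hsymm]
  have heq : (fun ξ : V => cexp (I * ((lam'' ξ ξ / 2 : ℝ) : ℂ)) • (1 : Matrix (Fin 1) (Fin 1) ℂ)) =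
      fun ξ : V => cexp (I * ((inner ℝ ξ (S ξ) : ℝ) : ℂ)) • (1 : Matrix (Fin 1) (Fin 1) ℂ) := by
    funext ξ
    rw [hSdef, inner_self_bilinOp]
    simp only [smul_apply, smul_eq_mul]
    congr 4
    ring
  rw [heq] at hscal
  have hS0 := eq_zero_of_isLpMultiplier_exp_I_inner_self' (0 : Fin 1) hSs hp1 hp2 hscal
  have := inner_self_bilinOp ((1 / 2 : ℝ) • lam'') v
  rw [← hSdef, hS0, LinearMap.zero_apply, inner_zero_right] at this
  simp only [smul_apply, smul_eq_mul] at this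
  linarith

/-! ### The `C^∞`-on-a-ball corollary -/

/-- On a ball where the phase `λ` is `C^∞`, the amplitude `A` is continuous and nowhere zero, and
the bound and the approximate phase relation hold uniformly: the theorem applies at every point,
so all second derivatives `λ''(ξ)(v, v)`, `ξ ∈ B`, vanish.
[cite: BrennerThomeeWahlbin1975, Ch. 5 §1, proof of Lemma 1.1, (1.4)] -/
theorem fderiv_fderiv_apply_eq_zero_of_localizedApproxPhaseBound [DecidableEq ι] [DecidableEq κ]
    {p : ℝ≥0∞} (hp1 : 1 ≤ p) (hp2 : p ≠ 2) {C : ℝ≥0} {N : ℕ → V → Matrix κ κ ℂ} {ξ₀ : V} {ρ : ℝ}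
    {θ : V → ℝ} (hθ : ∀ ξ ∈ ball ξ₀ ρ, θ ξ = 1)
    (hN : ∀ n, IsLpMultiplierWith p C (fun ξ => ((θ ξ : ℝ) : ℂ) • N n ξ))
    {lam : V → ℝ} (hlam : ContDiffOn ℝ ∞ lam (ball ξ₀ ρ))
    {P : V → Matrix κ ι ℂ} (hP : ∀ a b, ContDiffOn ℝ ∞ (fun ξ => P ξ a b) (ball ξ₀ ρ))
    {A : V → Matrix κ ι ℂ} (hA : ∀ a b, ContinuousOn (fun ξ => A ξ a b) (ball ξ₀ ρ))
    (hA0 : ∀ ξ ∈ ball ξ₀ ρ, A ξ ≠ 0)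
    {B : ℝ} (hB : ∀ n, ∀ ξ ∈ ball ξ₀ ρ, ∀ a b, ‖(N n ξ * P ξ) a b‖ ≤ B)
    (hNP : ∀ e : ℝ, 0 < e → ∀ᶠ n : ℕ in atTop, ∀ ξ ∈ ball ξ₀ ρ, ∀ a b,
      ‖(N n ξ * P ξ - cexp (I * ((((n : ℝ) + 1) * lam ξ : ℝ) : ℂ)) • A ξ) a b‖ ≤ e)
    {ξ₁ : V} (hξ₁ : ξ₁ ∈ ball ξ₀ ρ) (v : V) :
    fderiv ℝ (fderiv ℝ lam) ξ₁ v v = 0 := by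
  -- a ball around `ξ₁` inside `B`
  obtain ⟨ρ₁, hρ₁, hsub⟩ : ∃ ρ₁ > 0, ball ξ₁ ρ₁ ⊆ ball ξ₀ ρ :=
    Metric.isOpen_iff.1 isOpen_ball ξ₁ hξ₁
  have hopen : ball ξ₀ ρ ∈ 𝓝 ξ₁ := isOpen_ball.mem_nhds hξ₁
  have hcd : ContDiffAt ℝ ∞ lam ξ₁ := hlam.contDiffAt hopen
  have hdiff : ∀ ξ ∈ ball ξ₁ ρ₁, HasFDerivAt lam (fderiv ℝ lam ξ) ξ := fun ξ hξ =>
    ((hlam.differentiableOn (by simp)).differentiableAt (isOpen_ball.mem_nhds (hsub hξ))).hasFDerivAt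
  have hd2 : HasFDerivAt (fderiv ℝ lam) (fderiv ℝ (fderiv ℝ lam) ξ₁) ξ₁ :=
    ((hcd.fderiv_right (m := ∞) (by simp)).differentiableAt (by simp)).hasFDerivAt
  exact hessian_eq_zero_of_localizedApproxPhaseBound hp1 hp2 hρ₁ (fun ξ hξ => hθ ξ (hsub hξ)) hN
    hdiff hd2 (fun a b => (hP a b).mono hsub) (fun a b => (hA a b).continuousAt hopen) (hA0 ξ₁ hξ₁)
    (fun n ξ hξ a b => hB n ξ (hsub hξ) a b)
    (fun e he => (hNP e he).mono fun n hn ξ hξ a b => hn ξ (hsub hξ) a b) v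

end Literature.Analysis.Fourier

end
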